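import Summits.CriticalPhenomena.CardyFormulaZ2.Theses.CardyRotToConf
import Literature.Probability.RandomPlanarGeometry.ChordalCurveFamilyProofs
import Literature.Probability.RandomPlanarGeometry.BrownianLoopMarkedDecomposition
import Summits.CriticalPhenomena.CardyFormulaZ2.Theorems.CardyRotToConfR2SymmetryUpgrade.Negative.SurgConcatHit
import HarnessLib

/-!
# The breakpoint-moving reparametrisation and the stopped concatenation class
# (one-shot surgery for crux `CardyRotToConfR2SymmetryUpgrade`, stmt-CriticalPhenomena-0698)

`splitFun`/`splitMap`/`splitIso` and `stopAt_concat_of_forall_notMem` (class level).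
Negative lane: no Theses statement is asserted; overview in `Negative/OneShotSurgery.lean`.
-/

noncomputable section

open Set Filter Topology Metric
open scoped unitInterval
open Literature.Probability.RandomPlanarGeometry
open Literature.Probability.RandomPlanarGeometry.BrownianLoop

namespace Summit.CriticalPhenomena.CardyFormulaZ2.Theorems.CardyRotToConfR2SymmetryUpgrade.Negative

/-! ### The breakpoint-moving reparametrisation -/

section Split

/-- Piecewise-linear map of `ℝ` fixing `0` and `1`, linear on `(-∞, c]` and `[c, ∞)`, with
`c ↦ c'`. [folklore] -/
def splitFun (c c' : ℝ) (x : ℝ) : ℝ :=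
  if x ≤ c then x * c' / c else c' + (x - c) * (1 - c') / (1 - c)

variable {c c' : ℝ} (hc0 : 0 < c) (hc1 : c < 1) (hc0' : 0 < c') (hc1' : c' < 1)
include hc0 hc1 hc0' hc1'

omit hc0 hc1 hc0' hc1' in
/-- `splitFun_of_le`: splitFun of le (auxiliary lemma of the one-shot surgery; the statement is the specification). -/
theorem splitFun_of_le {x : ℝ} (hx : x ≤ c) : splitFun c c' x = x * c' / c := if_pos hx

omit hc0 hc1 hc0' hc1' in
/-- `splitFun_of_lt`: splitFun of lt (auxiliary lemma of the one-shot surgery; the statement is the specification). -/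
theorem splitFun_of_lt {x : ℝ} (hx : c < x) :
    splitFun c c' x = c' + (x - c) * (1 - c') / (1 - c) := if_neg (not_le.2 hx)

omit hc1 hc0' hc1' in
/-- `continuous_splitFun`: continuous splitFun (auxiliary lemma of the one-shot surgery; the statement is the specification). -/
theorem continuous_splitFun : Continuous (splitFun c c') := by
  refine Continuous.if_le (by fun_prop) (by fun_prop) continuous_id continuous_const ?_
  rintro x rfl
  have hx : x ≠ 0 := hc0.ne'
  rw [sub_self, zero_mul, zero_div, add_zero]
  field_simp

/-- `strictMono_splitFun`: strictMono splitFun (auxiliary lemma of the one-shot surgery; the statement is the specification). -/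
theorem strictMono_splitFun : StrictMono (splitFun c c') := by
  have h1c : 0 < 1 - c := by linarith
  have h1c' : 0 < 1 - c' := by linarith
  intro x y hxy
  rcases le_or_gt x c with hx | hx <;> rcases le_or_gt y c with hy | hy
  · rw [splitFun_of_le hx, splitFun_of_le hy]
    exact div_lt_div_of_pos_right (mul_lt_mul_of_pos_right hxy hc0') hc0
  · rw [splitFun_of_le hx, splitFun_of_lt hy]
    have h1 : x * c' / c ≤ c' := by
      rw [div_le_iff₀ hc0]; nlinarith
    have h2 : 0 < (y - c) * (1 - c') / (1 - c) := div_pos (mul_pos (by linarith) h1c') h1c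
    linarith
  · linarith
  · rw [splitFun_of_lt hx, splitFun_of_lt hy]
    have : (x - c) * (1 - c') / (1 - c) < (y - c) * (1 - c') / (1 - c) :=
      div_lt_div_of_pos_right (mul_lt_mul_of_pos_right (by linarith) h1c') h1c
    linarith

omit hc1 hc0' hc1' in
/-- `splitFun_zero`: splitFun zero (auxiliary lemma of the one-shot surgery; the statement is the specification). -/
theorem splitFun_zero : splitFun c c' 0 = 0 := by
  rw [splitFun_of_le hc0.le]; simp

omit hc0 hc0' hc1' in
/-- `splitFun_one`: splitFun one (auxiliary lemma of the one-shot surgery; the statement is the specification). -/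
theorem splitFun_one : splitFun c c' 1 = 1 := by
  rw [splitFun_of_lt hc1]
  have h1c : (1 : ℝ) - c ≠ 0 := by linarith
  field_simp
  ring

/-- `splitFun_mem`: splitFun mem (auxiliary lemma of the one-shot surgery; the statement is the specification). -/
theorem splitFun_mem {x : ℝ} (hx : x ∈ Icc (0 : ℝ) 1) : splitFun c c' x ∈ Icc (0 : ℝ) 1 := by
  have hm := (strictMono_splitFun hc0 hc1 hc0' hc1').monotone
  refine ⟨?_, ?_⟩
  · have := hm hx.1
    rwa [splitFun_zero hc0] at this
  · have := hm hx.2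
    rwa [splitFun_one hc1] at this

/-- The breakpoint map as a self-map of `[0,1]`. [folklore] -/
def splitMap (x : I) : I := ⟨splitFun c c' x, splitFun_mem hc0 hc1 hc0' hc1' x.2⟩

/-- `surjective_splitMap`: surjective splitMap (auxiliary lemma of the one-shot surgery; the statement is the specification). -/
theorem surjective_splitMap : Function.Surjective (splitMap hc0 hc1 hc0' hc1') := by
  intro y
  have hy : (y : ℝ) ∈ Icc (splitFun c c' 0) (splitFun c c' 1) := by
    rw [splitFun_zero hc0, splitFun_one hc1]
    exact y.2
  obtain ⟨x, hx, hxy⟩ :=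
    intermediate_value_Icc zero_le_one (continuous_splitFun hc0).continuousOn hy
  exact ⟨⟨x, hx⟩, Subtype.ext hxy⟩

/-- **The breakpoint-moving reparametrisation** `[0,c] → [0,c']`, `[c,1] → [c',1]`, linear on
both pieces: an increasing self-homeomorphism of `[0,1]`. [folklore] -/
def splitIso : I ≃o I :=
  StrictMono.orderIsoOfSurjective (splitMap hc0 hc1 hc0' hc1')
    (fun _ _ hxy => strictMono_splitFun hc0 hc1 hc0' hc1' hxy) (surjective_splitMap hc0 hc1 hc0' hc1')

/-- `coe_splitIso`: coe splitIso (auxiliary lemma of the one-shot surgery; the statement is the specification). -/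
theorem coe_splitIso (x : I) : (splitIso hc0 hc1 hc0' hc1' x : ℝ) = splitFun c c' x := rfl

end Split

/-! ### The class of the stopped concatenation when the first piece avoids `F` -/

section StopClass

variable {a b : C(I, ℂ)} {F : Set ℂ}

/-- If `b 0 ∉ F` then the hitting parameter of `b` is positive (closed `F`). [folklore] -/
theorem hitParam_pos_of_notMem (hF : IsClosed F) (h0 : b 0 ∉ F) :
    0 < (Curve.mk b).hitParam F := by
  have hmem := (Curve.mk b).hitParam_mem_Icc F
  rcases hmem.1.eq_or_lt with h | h
  · exfalso
    by_cases hex : ∃ t, (Curve.mk b) t ∈ F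
    · have := Curve.apply_hitParam_mem hF hex
      apply h0
      have e : (⟨(Curve.mk b).hitParam F, hmem⟩ : I) = 0 := Subtype.ext h.symm
      rw [e] at this
      exact this
    · have hex' : ∀ t, (Curve.mk b) t ∉ F := fun t ht => hex ⟨t, ht⟩
      have := Curve.hitParam_eq_one_of_forall_notMem hex'
      rw [this] at h
      exact one_ne_zero h.symm
  · exact h

/-- The stopped second piece starts where `b` starts. -/
theorem stopAt_toContinuousMap_zero (F : Set ℂ) :
    ((Curve.mk b).stopAt F).toContinuousMap 0 = b 0 := by
  show (Curve.mk b).stopAt F 0 = b 0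
  rw [Curve.stopAt_apply]
  simp [projIcc]
  rfl

/-- **Stopped during the second piece, class level.** If `a` avoids the closed set `F`, the class
of the concatenation stopped at `F` is the concatenation of the class of `a` with the class of `b`
stopped at `F` (the two parametrised curves differ by the breakpoint-moving reparametrisation
`splitIso (1/(2T)) (1/2)`, `T = (1 + T_b)/2`). [folklore] -/
theorem stopAt_concat_of_forall_notMem (hab : a 1 = b 0) (hF : IsClosed F) (hFa : ∀ t, a t ∉ F) :
    CurveClass.stopAt F (mkCM (concatCM a b)) =
      concatClass (mkCM a) (CurveClass.stopAt F (mkCM b)) := by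
  set Tb := (Curve.mk b).hitParam F with hTb
  have hTb_mem := (Curve.mk b).hitParam_mem_Icc F
  have hTb_pos : 0 < Tb := hitParam_pos_of_notMem hF (by rw [← hab]; exact hFa 1)
  set T := (1 + Tb) / 2 with hT
  have hT_pos : 0 < T := by rw [hT]; linarith
  have hT_le : T ≤ 1 := by rw [hT]; linarith [hTb_mem.2]
  have hTw : (Curve.mk (concatCM a b)).hitParam F = T := hitParam_concat_of_forall_notMem hab hFa
  -- the two parametrised curves
  set w₁ : C(I, ℂ) := ((Curve.mk (concatCM a b)).stopAt F).toContinuousMap with hw₁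
  set b' : C(I, ℂ) := ((Curve.mk b).stopAt F).toContinuousMap with hb'
  have hab' : a 1 = b' 0 := by rw [hb', stopAt_toContinuousMap_zero, hab]
  set w₂ : C(I, ℂ) := concatCM a b' with hw₂
  have hL : CurveClass.stopAt F (mkCM (concatCM a b)) = mkCM w₁ := by
    rw [mkCM, CurveClass.stopAt_mk_holds F hF]; rfl
  have hR : concatClass (mkCM a) (CurveClass.stopAt F (mkCM b)) = mkCM w₂ := by
    rw [mkCM, mkCM, CurveClass.stopAt_mk_holds F hF, hw₂, hb', mkCM_concatCM]; rfl
  rw [hL, hR, mkCM_eq_mkCM_iff]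
  -- reparametrisation: breakpoint `c = 1/(2T)` to `1/2`
  set c : ℝ := 1 / (2 * T) with hc
  have hc0 : 0 < c := by positivity
  have hc1 : c < 1 := by
    rw [hc, div_lt_one (by positivity)]; rw [hT]; linarith
  have hc0' : (0 : ℝ) < 1 / 2 := by norm_num
  have hc1' : (1 : ℝ) / 2 < 1 := by norm_num
  set φ := splitIso hc0 hc1 hc0' hc1' with hφ
  refine le_antisymm ?_ dist_nonneg
  refine (Curve.reparamDist_le (Curve.mk w₁) (Curve.mk w₂) φ).trans (le_of_eq ?_)
  rw [dist_eq_zero]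
  ext r : 1
  show w₁ r = w₂ (φ r)
  -- evaluate `w₁ r = w (T r)`
  have hTr : T * r ∈ Icc (0 : ℝ) 1 :=
    ⟨mul_nonneg hT_pos.le r.2.1, mul_le_one₀ hT_le r.2.1 r.2.2⟩
  have e₁ : w₁ r = concatCM a b ⟨T * r, hTr⟩ := by
    rw [hw₁]
    show (Curve.mk (concatCM a b)).stopAt F r = _
    rw [Curve.stopAt_apply, hTw, projIcc_of_mem _ hTr]
    rfl
  rw [e₁]
  rcases le_or_gt (r : ℝ) c with hrc | hrc
  · -- first piece on both sides: `φ r = T r ≤ 1/2`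
    have hφr : (φ r : ℝ) = T * r := by
      rw [hφ, coe_splitIso, splitFun_of_le hrc, hc]
      field_simp
    have hle : T * r ≤ 1 / 2 := by
      calc T * r ≤ T * c := by gcongr
        _ = 1 / 2 := by rw [hc]; field_simp
    have hle₁ : ((⟨T * r, hTr⟩ : I) : ℝ) ≤ 1 / 2 := hle
    have hle₂ : ((φ r : I) : ℝ) ≤ 1 / 2 := by rw [hφr]; exact hle
    rw [concatCM_apply_of_eq hab, if_pos hle₁, hw₂, concatCM_apply_of_eq hab', if_pos hle₂]
    congr 1
    exact Subtype.ext (by rw [coe_dbl₁ hle₁, coe_dbl₁ hle₂, hφr])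
  · -- second piece on both sides
    have h1c : (1 : ℝ) - c ≠ 0 := by linarith
    have hφr : (φ r : ℝ) = 1 / 2 + (r - c) * (1 - 1 / 2) / (1 - c) := by
      rw [hφ, coe_splitIso, splitFun_of_lt hrc]
    have hgt : 1 / 2 < T * r := by
      calc (1 : ℝ) / 2 = T * c := by rw [hc]; field_simp
        _ < T * r := by gcongr
    have hgt₁ : ¬ ((⟨T * r, hTr⟩ : I) : ℝ) ≤ 1 / 2 := not_le.2 hgt
    have hgt₂ : ¬ ((φ r : I) : ℝ) ≤ 1 / 2 := by
      rw [hφr, not_le]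
      have : 0 < (r - c) * (1 - 1 / 2) / (1 - c) :=
        div_pos (mul_pos (by linarith) (by norm_num)) (by linarith)
      linarith
    rw [concatCM_apply_of_eq hab, if_neg hgt₁, hw₂, concatCM_apply_of_eq hab', if_neg hgt₂, hb']
    show b (dbl₂ ⟨T * r, hTr⟩) = (Curve.mk b).stopAt F (dbl₂ (φ r))
    rw [Curve.stopAt_apply]
    have hmem : Tb * (dbl₂ (φ r) : ℝ) ∈ Icc (0 : ℝ) 1 :=
      ⟨mul_nonneg hTb_mem.1 (dbl₂ (φ r)).2.1, mul_le_one₀ hTb_mem.2 (dbl₂ (φ r)).2.1 (dbl₂ (φ r)).2.2⟩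
    rw [projIcc_of_mem _ hmem]
    show b (dbl₂ ⟨T * r, hTr⟩) = b ⟨Tb * (dbl₂ (φ r) : ℝ), hmem⟩
    congr 1
    apply Subtype.ext
    show ((dbl₂ ⟨T * r, hTr⟩ : I) : ℝ) = Tb * (dbl₂ (φ r) : ℝ)
    rw [coe_dbl₂ (not_le.1 hgt₁).le, coe_dbl₂ (not_le.1 hgt₂).le]
    show 2 * (T * (r : ℝ)) - 1 = Tb * (2 * (φ r : ℝ) - 1)
    have key : ∀ ρ : ℝ,
        2 * (1 / 2 + (ρ - c) * (1 - 1 / 2) / (1 - c)) - 1 = (ρ - c) / (1 - c) := by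
      intro ρ; ring
    rw [hφr, key, ← mul_div_assoc, eq_div_iff h1c]
    have hcT : c * (2 * T) = 1 := by rw [hc]; exact one_div_mul_cancel (by positivity)
    have hTb' : Tb = 2 * T - 1 := by rw [hT]; ring
    linear_combination (1 - (r : ℝ)) * hcT - ((r : ℝ) - c) * hTb'

end StopClass

end Summit.CriticalPhenomena.CardyFormulaZ2.Theorems.CardyRotToConfR2SymmetryUpgrade.Negative
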